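import Literature.MathematicalPhysics.QuantumFieldTheory.Balaban1983to89.B9Eq334LaplaceACovariance
import Literature.MathematicalPhysics.QuantumFieldTheory.Balaban1983to89.B9Thm311SmallFieldClosedUniform

/-!
# `Balaban1983to89.B9Thm311GaugeOrbitClosed` — T. Bałaban, *Propagators for lattice gauge theories in a background field*, Commun. Math. Phys.
# **99** (1985) 389–434 [Balaban1985BackgroundPropagators] Thm 3.11 p. 416 with (3.34)–(3.35) p. 396: THM 3.11 «Δ_a IS POSITIVE DEFINITE» FOR THE
# pub-balaban NE9 CHAIN'S ASSEMBLED `Δ_a(U)` ON THE GAUGE ORBIT OF THE SMALL-FIELD BALL — every background `V = U^u` with `‖U(b) − 1‖ ≤ ε`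
# (print's regularity class (3.35) on the one-cube torus: *«there exists a gauge transformation u on □ such that U^u = e^{iηA}, |A| …»*), with the
# SAME volume-free constants `γ₁, ε₃` as at the small field itself

statement-level skeleton of published theorems with citation tags; proofs where landed; nothing here is a claim about the Yang–Mills mass gap

PDF held: `paper:balaban1985-cmp99-background-propagators` (journal page = PDF page + 388), pp. 396, 416 read by this seat (2026-08-22, text layer).

THE PRINT (verbatim).  p. 396: *«This implies the transformation laws for the operators Δ_a and G: Δ_a(U^u) = R(u)Δ_a(U)R(u⁻¹), G(U^u) =
R(u)G(U)R(u⁻¹). (3.34) Now we will introduce the regularity conditions for gauge field configurations U. … for a configuration U there exists a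
gauge transformation u on □ such that U^u = e^{iηA}, and if the index of □ is j, then |A| < O(1)Mα₀(L^jη)⁻¹, |∇^η A| < O(1)Mα₀(L^jη)⁻² on □,
(3.35)»*; p. 416, Theorem 3.11: *«the operators Δ′_a, G′, (Q′G′²Q′*)⁻¹, Δ_a, G are positive definite.»*

WHY THIS FILE (cell context).  Every chart theorem of the pub-balaban NE9 chain ((C2)(E)(F′)(H1)(H2)(S′), the leaves' volume-uniform twins) is stated
at a SMALL FIELD `‖U(b) − 1‖ ≤ ε`; print's hypotheses are on the gauge-equivalence CLASS (3.35).  With (3.34) typed on the chain's carriers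
(`B9Eq334LaplaceACovariance`) the positivity half of Thm 3.11 passes to the orbit at no cost in the constants: the quadratic form of `Δ_a` and the
weighted `L²` norm are both invariant under `R(u)` (`inner_laplaceAofBackground_gaugeU`, `B9Eq328GaugeAction.norm_gaugeW`).  This file records it,
composed with ne9-leaf-03 g58/g59's volume-uniform (E′) `B9Thm311SmallFieldClosedUniform.exists_coercive_laplaceA_of_small_field_uniform`.

WHAT IS PROVED (sorry-free; 0 `def`; no NEW inequality — a printed one transported along the orbit).
* §0 `star_gaugeU` (unitary bond variables stay unitary under unitary `u`), **`hRS_gaugeU`** (the transporters' mutual adjointness `hRS` — a letter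
  of every chart theorem — transfers to `U^u` given `hAd`); with `B9Eq333ProjectionCovariance.hU1_gaugeU/hreg_gaugeU` and §2's `hpos`, EVERY displayed
  background letter of the chain's chart theorems is now available at `V = U^u`.
* §1 **`coercive_laplaceAofBackground_gaugeU`** — a coercivity bound `γ‖x‖² ≤ re⟨x, Δ_a(U)x⟩` for ALL `x` holds for `Δ_a(U^u)` with the SAME `γ`
  (given the three displayed readings `hAd`, `hτ`, `hstar` of print's `U(N)`/`tr`); `norm_G1_le_gaugeU` (`‖G₁(U^u)y‖ ≤ γ⁻¹‖y‖` likewise).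
* §2 **`exists_coercive_laplaceA_of_gaugeOrbit_small_field_uniform`** — [B9] THM 3.11 (second half) ON THE GAUGE ORBIT OF THE SMALL-FIELD BALL,
  VOLUME-UNIFORM: `∃ γ₁ ε₃ > 0` (the (E′) pair — numbers of `d, L, η, a, c₀, c₁, M_φ, M_φ′, C_τ`) such that for EVERY volume `m`, EVERY `U` with
  `‖U(b) − 1‖ ≤ ε ≤ ε₃` (unit-bounded, block-regular, mutually adjoint transporters) and EVERY gauge function `u` with `u(x) ∈ U1` unitary,
  `τ`-central and fibrewise isometric: `γ₁‖x‖² ≤ re⟨x, Δ_a(U^u)x⟩` for all `x` — with the regularity witnesses of `U^u` SUPPLIED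
  (`B9Eq333ProjectionCovariance.hU1_gaugeU/hreg_gaugeU`); **`laplaceAofBackground_pos_of_gaugeOrbit_small_field_uniform`** (positive definiteness,
  the `hpos` slot of the chain's letters `G₁/H₁/𝔊` at `V = U^u`); **`norm_G1_le_of_gaugeOrbit_small_field_uniform`** (`‖G₁(U^u)y‖ ≤ γ₁⁻¹‖y‖`,
  `B9Eq3126GreenLetters.norm_greenK_le`).
MODEL / DECLARED READINGS.  (M1) the chain's encodings verbatim; the orbit is parametrised as `V = gaugeU g U` (print: `V` with `V^{u} = U` small,
`u = g⁻¹`); (M2) DISPLAYED: the (E′) data letters (`η ≠ 0`, `a > 0`, `‖φ‖ ≤ M_φ`, `‖φ⁻¹‖ ≤ M_φ′`, `‖τ‖ ≤ C_τ`), `hRS` at `U`, and for `g`: `g(x) ∈ U1`,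
`hstar`, `hτ`, `hAd`; (M3) NOT HERE: the derivative half of (3.35) (`|∇^η A|`), multi-cube classes (the index `j`, enlarged cubes), the first half of Thm 3.11 (`Δ′_a`, `G′`
— other carriers), decay (Thm 3.12 ff.), the chart theorems (S′)/(H2) on the orbit.
v1.1 (DOCFIX, reader ne9-leaf-02 g59 INBOX l.31179): the (3.35) quotation's domain reads «on □,» — no tilde is visible on the page renders (the
v1 header had `□̃`, an over-reading of the text layer's glyph); declarations byte-identical.
HONEST SCOPE.  Composition BY NAME of tree theorems; the constants are (E′)'s, untouched; nothing new of [B9] asserted; NOT summit progress (cell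
pub-balaban: NE9 NOT PRINTED / NOT PROVED; «NE9 ⇐ the named binders»; spine PROVED 0/9; HONEST DEPENDENCY: continuum YM on T⁴ ⇐ BetaPertH ∧ nine
spine estimates (0/9 proved); BetaPertH ⇐ (D1) ∧ (D4) ∧ CAP+tail; G-an2-4 gates asym, D1 and NE2/3/4).  Unit `b2b-balaban-t4-ne9-formalise-leaf-03`
(NE9 crux-team leaf prover, gen 60), INTENT I-ne9leaf03-g60-1 file (G4); NEW file importing `B9Eq334LaplaceACovariance` + `B9Thm311SmallFieldClosedUniform`;
modifies nothing.  Net new unproved facts: 0.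
-/

noncomputable section

open scoped InnerProductSpace ComplexConjugate BigOperators

namespace Literature.MathematicalPhysics.QuantumFieldTheory.Balaban1983to89.B9Thm311GaugeOrbitClosed

open B9SectCLatticeCarrier (Bond bpos btgt)
open B4Sect5Torus (TSite)
open B9Eq311L2Pairing (WL2)
open B9Eq319QprimeTorus (fineP)
open B11Eq103H1Complex (BondL2K G1LatticeK)
open B9Eq310HessianOperator (adTransportW)
open B7Prop1Explicit (U1 Wcx boxVec)
open B9Eq315QTorus (perCfg cornerSite laplaceAofBackground)
open B9Eq3126GreenLetters (norm_greenK_le)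
open B9Thm311SmallFieldClosedUniform (exists_coercive_laplaceA_of_small_field_uniform)
open B9Eq328GaugeAction B9Eq333ProjectionCovariance B9Eq334LaplaceACovariance

variable {d : ℕ} (L : ℕ) [NeZero L] (hL : 1 ≤ L)
  {𝔸 : Type*} [NormedRing 𝔸] [NormedAlgebra ℂ 𝔸] [CompleteSpace 𝔸] [NormOneClass 𝔸] [StarRing 𝔸] [NormedStarGroup 𝔸] [StarModule ℂ 𝔸]
  {W : Type*} [NormedAddCommGroup W] [InnerProductSpace ℂ W] [FiniteDimensional ℂ W] (φ : W ≃ₗ[ℂ] 𝔸) {c₀ c₁ : ℝ} [Fact (0 < c₀)] [Fact (0 < c₁)]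
  (τ : 𝔸 →ₗ[ℂ] ℂ)

/-! ## §0 The displayed letters of the chart theorems transfer along the orbit: unitarity of the bond variables, `hRS` -/

section Letters

variable {P : Fin d → ℕ} (g : TSite d P → 𝔸ˣ) (U : Bond d P → 𝔸ˣ)

omit [NeZero L] [NormedAlgebra ℂ 𝔸] [CompleteSpace 𝔸] [NormOneClass 𝔸] [NormedStarGroup 𝔸] [StarModule ℂ 𝔸] in
/-- **Unitary bond variables stay unitary under a unitary gauge transformation**: `(U^u(b))* = U^u(b)⁻¹` — the letter `hU` of
`B9Eq315QTorusOnto.laplaceAofBackground_isSymmetric` / `B9Thm311SmallFieldClosed.hRS_of_unitary` at `V = U^u`. [cite: Balaban1985BackgroundPropagators, (3.28) p.395, p.391] -/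
theorem star_gaugeU (hU : ∀ b, star (U b : 𝔸) = ((U b)⁻¹ : 𝔸ˣ)) (hstar : ∀ x, star (g x : 𝔸) = ((g x)⁻¹ : 𝔸ˣ)) (b : Bond d P) :
    star ((gaugeU g U b : 𝔸ˣ) : 𝔸) = (((gaugeU g U b)⁻¹ : 𝔸ˣ) : 𝔸) := by
  have h' : ∀ x, star (((g x)⁻¹ : 𝔸ˣ) : 𝔸) = (g x : 𝔸) := fun x => by rw [← hstar, star_star]
  rw [gaugeU_inv_apply, gaugeU_apply]
  simp only [Units.val_mul, star_mul, h', hU, hstar, mul_assoc]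

omit [NeZero L] [CompleteSpace 𝔸] [NormOneClass 𝔸] [StarRing 𝔸] [NormedStarGroup 𝔸] [StarModule ℂ 𝔸] [FiniteDimensional ℂ W] in
/-- **The mutual adjointness `hRS` of the transporters `R(U(b))`, `R(U(b)⁻¹)` on the fibre transfers to `U^u`** for fibrewise isometric `R(u(x))`
(`hAd`) — the letter `hRS` of every chart theorem of the chain at `V = U^u`. [cite: Balaban1985BackgroundPropagators, (3.28) p.395, (3.8)–(3.10) p.392] -/
theorem hRS_gaugeU (hAd : ∀ (x : TSite d P) (v v' : W), ⟪AdW φ (g x) v, AdW φ (g x) v'⟫_ℂ = ⟪v, v'⟫_ℂ)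
    (hRS : ∀ (b : Bond d P) (v u : W), ⟪adTransportW φ U b v, u⟫_ℂ = ⟪v, adTransportW φ (fun b => (U b)⁻¹) b u⟫_ℂ) (b : Bond d P) (v u : W) :
    ⟪adTransportW φ (gaugeU g U) b v, u⟫_ℂ = ⟪v, adTransportW φ (fun b => (gaugeU g U b)⁻¹) b u⟫_ℂ := by
  have hadj : ∀ (x : TSite d P) (v u : W), ⟪AdW φ (g x) v, u⟫_ℂ = ⟪v, AdW φ (g x)⁻¹ u⟫_ℂ := fun x v u => by
    conv_lhs => rw [← AdW_apply_inv φ (g x) u]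
    rw [hAd]
  have hadj' : ∀ (x : TSite d P) (v u : W), ⟪AdW φ (g x)⁻¹ v, u⟫_ℂ = ⟪v, AdW φ (g x) u⟫_ℂ := fun x v u => by
    rw [← hAd x, AdW_apply_inv]
  rw [adTransportW_gaugeU, adTransportW_gaugeU_inv, hadj, hRS, hadj']

end Letters

/-! ## §1 Coercivity and the `G₁`-bound pass to `U^u` with the same constant -/

section Transfer

variable (η : ℝ) (m : Fin d → ℕ) [∀ i, NeZero (fineP L m i)] {g : TSite d (fineP L m) → 𝔸ˣ} (U : Bond d (fineP L m) → 𝔸ˣ) {α : ℝ} (hα1 : α ≤ 1 / 64)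
  (hU1 : ∀ (x : B7Prop1Explicit.Site d) (κ : Fin d), perCfg (fineP L m) U x κ ∈ U1 𝔸)
  (hreg : ∀ (y : TSite d m) (κ : Fin d) (r : Fin d → Fin L),
    ‖((Wcx L (perCfg (fineP L m) U) (cornerSite L y) κ (boxVec L r) : 𝔸ˣ) : 𝔸) - 1‖ ≤ α)
  (hU1' : ∀ (x : B7Prop1Explicit.Site d) (κ : Fin d), perCfg (fineP L m) (gaugeU g U) x κ ∈ U1 𝔸)
  (hreg' : ∀ (y : TSite d m) (κ : Fin d) (r : Fin d → Fin L),
    ‖((Wcx L (perCfg (fineP L m) (gaugeU g U)) (cornerSite L y) κ (boxVec L r) : 𝔸ˣ) : 𝔸) - 1‖ ≤ α)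
  (hτ : ∀ (x : TSite d (fineP L m)) (X : 𝔸), τ (AdA (g x) X) = τ X) (hstar : ∀ x, star (g x : 𝔸) = ((g x)⁻¹ : 𝔸ˣ))
  (hAd : ∀ (x : TSite d (fineP L m)) (v v' : W), ⟪AdW φ (g x) v, AdW φ (g x) v'⟫_ℂ = ⟪v, v'⟫_ℂ)

omit [NormedStarGroup 𝔸] in
include hU1 hreg hτ hstar hAd in
/-- **A coercivity bound for `Δ_a(U)` holds for `Δ_a(U^u)` with the SAME constant**: the quadratic form ((3.34)) and the norm (`R(u)` unitary) are
both invariant. [cite: Balaban1985BackgroundPropagators, Thm 3.11 p.416, (3.34) p.396] -/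
theorem coercive_laplaceAofBackground_gaugeU (a : ℝ) {γ : ℝ}
    (hcoer : ∀ x : BondL2K ℂ d (fineP L m) c₀ W,
      γ * ‖x‖ ^ 2 ≤ RCLike.re ⟪x, laplaceAofBackground L m hL φ U hα1 hU1 hreg τ η (c₁ := c₁) a x⟫_ℂ)
    (x : BondL2K ℂ d (fineP L m) c₀ W) :
    γ * ‖x‖ ^ 2 ≤ RCLike.re ⟪x, laplaceAofBackground L m hL φ (gaugeU g U) hα1 hU1' hreg' τ η (c₁ := c₁) a x⟫_ℂ := by
  obtain ⟨y, rfl⟩ : ∃ y, gaugeW φ (fun b : Bond d (fineP L m) => g (bpos b)) y = x := ⟨_, gaugeW_apply_inv φ _ x⟩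
  rw [inner_laplaceAofBackground_gaugeU L m hL φ U hα1 hU1 hreg hU1' hreg' τ η hτ hstar hAd,
    norm_gaugeW φ (w := fun _ : Bond d (fineP L m) => c₀) _ fun b => hAd (bpos b)]
  exact hcoer y

omit [NormedStarGroup 𝔸] in
include hU1 hreg hτ hstar hAd in
/-- … hence `‖G₁(U^u)y‖ ≤ γ⁻¹‖y‖` for any positivity witness at `U^u` (`B9Eq3126GreenLetters.norm_greenK_le`).
[cite: Balaban1985BackgroundPropagators, Thm 3.11 p.416, (3.34) p.396, (3.86) p.407] -/
theorem norm_G1_le_gaugeU (a : ℝ) {γ : ℝ} (hγ : 0 < γ)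
    (hcoer : ∀ x : BondL2K ℂ d (fineP L m) c₀ W,
      γ * ‖x‖ ^ 2 ≤ RCLike.re ⟪x, laplaceAofBackground L m hL φ U hα1 hU1 hreg τ η (c₁ := c₁) a x⟫_ℂ)
    (hpos' : ∀ x : BondL2K ℂ d (fineP L m) c₀ W, x ≠ 0 →
      0 < RCLike.re ⟪x, laplaceAofBackground L m hL φ (gaugeU g U) hα1 hU1' hreg' τ η (c₁ := c₁) a x⟫_ℂ)
    (y : BondL2K ℂ d (fineP L m) c₀ W) : ‖G1LatticeK hpos' y‖ ≤ γ⁻¹ * ‖y‖ :=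
  norm_greenK_le hγ (coercive_laplaceAofBackground_gaugeU L hL φ τ η m U hα1 hU1 hreg hU1' hreg' hτ hstar hAd a hcoer) hpos' y

end Transfer

/-! ## §2 [B9] Thm 3.11 (second half) on the gauge orbit of the small-field ball, volume-uniform -/

section Orbit

/-- **[B9] THM 3.11 «Δ_a IS POSITIVE DEFINITE» ON THE GAUGE ORBIT OF THE SMALL-FIELD BALL, WITH THE SMALL-FIELD CONSTANTS**: ONE pair
`γ₁, ε₃ > 0` such that on EVERY lattice `TSite d (L·m)`, for EVERY background `U` with `‖U(b) − 1‖ ≤ ε ≤ ε₃` (unit-bounded, block-regular, mutually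
adjoint transporters) and EVERY gauge function `u` (`u(x) ∈ U1` unitary, `τ`-central, fibrewise isometric): `γ₁‖x‖² ≤ re⟨x, Δ_a(U^u)x⟩` — the
regularity witnesses of `U^u` being those TRANSPORTED from `U` (`hU1_gaugeU`, `hreg_gaugeU`).
[cite: Balaban1985BackgroundPropagators, Thm 3.11 p.416, (3.34)–(3.35) p.396] -/
theorem exists_coercive_laplaceA_of_gaugeOrbit_small_field_uniform {η : ℝ} (hη : η ≠ 0) {a : ℝ} (ha : 0 < a) {Mφ Mφ' : ℝ} (hMφ : 0 ≤ Mφ)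
    (hMφ' : 0 ≤ Mφ') (hφ : ∀ w, ‖φ w‖ ≤ Mφ * ‖w‖) (hφ' : ∀ X, ‖φ.symm X‖ ≤ Mφ' * ‖X‖) {Cτ : ℝ} (hτC : ∀ X, ‖τ X‖ ≤ Cτ * ‖X‖)
    (hCτ : 0 ≤ Cτ) :
    ∃ γ₁ ε₃ : ℝ, 0 < γ₁ ∧ 0 < ε₃ ∧ ∀ (m : Fin d → ℕ) [∀ i, NeZero (fineP L m i)]
      (U : Bond d (fineP L m) → 𝔸ˣ) {α : ℝ} (hα1 : α ≤ 1 / 64)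
      (hU1 : ∀ (x : B7Prop1Explicit.Site d) (κ : Fin d), perCfg (fineP L m) U x κ ∈ U1 𝔸)
      (hreg : ∀ (y : TSite d m) (κ : Fin d) (r : Fin d → Fin L), ‖((Wcx L (perCfg (fineP L m) U) (cornerSite L y) κ (boxVec L r) : 𝔸ˣ) : 𝔸) - 1‖ ≤ α)
      {ε : ℝ}, 0 ≤ ε → ε ≤ ε₃ → (∀ b, ‖(U b : 𝔸) - 1‖ ≤ ε) →
      (∀ (b : Bond d (fineP L m)) (v u : W), ⟪adTransportW φ U b v, u⟫_ℂ = ⟪v, adTransportW φ (fun b => (U b)⁻¹) b u⟫_ℂ) →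
      ∀ (g : TSite d (fineP L m) → 𝔸ˣ) (hg : ∀ x, g x ∈ U1 𝔸), (∀ x, star (g x : 𝔸) = ((g x)⁻¹ : 𝔸ˣ)) →
        (∀ (x : TSite d (fineP L m)) (X : 𝔸), τ (AdA (g x) X) = τ X) →
        (∀ (x : TSite d (fineP L m)) (v v' : W), ⟪AdW φ (g x) v, AdW φ (g x) v'⟫_ℂ = ⟪v, v'⟫_ℂ) →
        ∀ x : BondL2K ℂ d (fineP L m) c₀ W, γ₁ * ‖x‖ ^ 2 ≤
          RCLike.re ⟪x, laplaceAofBackground L m hL φ (gaugeU g U) hα1 (hU1_gaugeU L m g U hg hU1) (hreg_gaugeU L m g U hg hreg) τ η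
            (c₀ := c₀) (c₁ := c₁) a x⟫_ℂ := by
  obtain ⟨γ₁, ε₃, hγ₁, hε₃, H⟩ :=
    exists_coercive_laplaceA_of_small_field_uniform L hL φ (c₀ := c₀) (c₁ := c₁) hη ha hMφ hMφ' hφ hφ' τ hτC hCτ
  refine ⟨γ₁, ε₃, hγ₁, hε₃, fun m _ U α hα1 hU1 hreg ε hε hεε₃ hUε hRS g hg hstar hτ hAd x => ?_⟩
  exact coercive_laplaceAofBackground_gaugeU L hL φ τ η m U hα1 hU1 hreg _ _ hτ hstar hAd a (H m U hα1 hU1 hreg hε hεε₃ hUε hRS) x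

/-- **THE `hpos` SLOT OF THE CHAIN'S LETTERS AT EVERY `V = U^u`, `U` SMALL** — positive definiteness of `Δ_a(U^u)` (from the coercivity above).
[cite: Balaban1985BackgroundPropagators, Thm 3.11 p.416, (3.34)–(3.35) p.396] -/
theorem laplaceAofBackground_pos_of_gaugeOrbit_small_field_uniform {η : ℝ} (hη : η ≠ 0) {a : ℝ} (ha : 0 < a) {Mφ Mφ' : ℝ} (hMφ : 0 ≤ Mφ)
    (hMφ' : 0 ≤ Mφ') (hφ : ∀ w, ‖φ w‖ ≤ Mφ * ‖w‖) (hφ' : ∀ X, ‖φ.symm X‖ ≤ Mφ' * ‖X‖) {Cτ : ℝ} (hτC : ∀ X, ‖τ X‖ ≤ Cτ * ‖X‖)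
    (hCτ : 0 ≤ Cτ) :
    ∃ ε₃ : ℝ, 0 < ε₃ ∧ ∀ (m : Fin d → ℕ) [∀ i, NeZero (fineP L m i)]
      (U : Bond d (fineP L m) → 𝔸ˣ) {α : ℝ} (hα1 : α ≤ 1 / 64)
      (hU1 : ∀ (x : B7Prop1Explicit.Site d) (κ : Fin d), perCfg (fineP L m) U x κ ∈ U1 𝔸)
      (hreg : ∀ (y : TSite d m) (κ : Fin d) (r : Fin d → Fin L), ‖((Wcx L (perCfg (fineP L m) U) (cornerSite L y) κ (boxVec L r) : 𝔸ˣ) : 𝔸) - 1‖ ≤ α)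
      {ε : ℝ}, 0 ≤ ε → ε ≤ ε₃ → (∀ b, ‖(U b : 𝔸) - 1‖ ≤ ε) →
      (∀ (b : Bond d (fineP L m)) (v u : W), ⟪adTransportW φ U b v, u⟫_ℂ = ⟪v, adTransportW φ (fun b => (U b)⁻¹) b u⟫_ℂ) →
      ∀ (g : TSite d (fineP L m) → 𝔸ˣ) (hg : ∀ x, g x ∈ U1 𝔸), (∀ x, star (g x : 𝔸) = ((g x)⁻¹ : 𝔸ˣ)) →
        (∀ (x : TSite d (fineP L m)) (X : 𝔸), τ (AdA (g x) X) = τ X) →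
        (∀ (x : TSite d (fineP L m)) (v v' : W), ⟪AdW φ (g x) v, AdW φ (g x) v'⟫_ℂ = ⟪v, v'⟫_ℂ) →
        ∀ x : BondL2K ℂ d (fineP L m) c₀ W, x ≠ 0 →
          0 < RCLike.re ⟪x, laplaceAofBackground L m hL φ (gaugeU g U) hα1 (hU1_gaugeU L m g U hg hU1) (hreg_gaugeU L m g U hg hreg) τ η
            (c₀ := c₀) (c₁ := c₁) a x⟫_ℂ := by
  obtain ⟨γ₁, ε₃, hγ₁, hε₃, H⟩ :=
    exists_coercive_laplaceA_of_gaugeOrbit_small_field_uniform L hL φ τ (c₀ := c₀) (c₁ := c₁) hη ha hMφ hMφ' hφ hφ' hτC hCτ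
  refine ⟨ε₃, hε₃, fun m _ U α hα1 hU1 hreg ε hε hεε₃ hUε hRS g hg hstar hτ hAd x hx => ?_⟩
  have h := H m U hα1 hU1 hreg hε hεε₃ hUε hRS g hg hstar hτ hAd x
  have hx' : 0 < ‖x‖ ^ 2 := by positivity
  nlinarith

/-- **`‖G₁(U^u)y‖ ≤ γ₁⁻¹‖y‖` ON THE GAUGE ORBIT OF THE SMALL-FIELD BALL, ONE `γ₁` FOR ALL VOLUMES** — for any positivity witness at `U^u`.
[cite: Balaban1985BackgroundPropagators, Thm 3.11 p.416, (3.34) p.396, (3.86) p.407] -/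
theorem norm_G1_le_of_gaugeOrbit_small_field_uniform {η : ℝ} (hη : η ≠ 0) {a : ℝ} (ha : 0 < a) {Mφ Mφ' : ℝ} (hMφ : 0 ≤ Mφ) (hMφ' : 0 ≤ Mφ')
    (hφ : ∀ w, ‖φ w‖ ≤ Mφ * ‖w‖) (hφ' : ∀ X, ‖φ.symm X‖ ≤ Mφ' * ‖X‖) {Cτ : ℝ} (hτC : ∀ X, ‖τ X‖ ≤ Cτ * ‖X‖) (hCτ : 0 ≤ Cτ) :
    ∃ γ₁ ε₃ : ℝ, 0 < γ₁ ∧ 0 < ε₃ ∧ ∀ (m : Fin d → ℕ) [∀ i, NeZero (fineP L m i)]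
      (U : Bond d (fineP L m) → 𝔸ˣ) {α : ℝ} (hα1 : α ≤ 1 / 64)
      (hU1 : ∀ (x : B7Prop1Explicit.Site d) (κ : Fin d), perCfg (fineP L m) U x κ ∈ U1 𝔸)
      (hreg : ∀ (y : TSite d m) (κ : Fin d) (r : Fin d → Fin L), ‖((Wcx L (perCfg (fineP L m) U) (cornerSite L y) κ (boxVec L r) : 𝔸ˣ) : 𝔸) - 1‖ ≤ α)
      {ε : ℝ}, 0 ≤ ε → ε ≤ ε₃ → (∀ b, ‖(U b : 𝔸) - 1‖ ≤ ε) →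
      (∀ (b : Bond d (fineP L m)) (v u : W), ⟪adTransportW φ U b v, u⟫_ℂ = ⟪v, adTransportW φ (fun b => (U b)⁻¹) b u⟫_ℂ) →
      ∀ {g : TSite d (fineP L m) → 𝔸ˣ}, (∀ x, star (g x : 𝔸) = ((g x)⁻¹ : 𝔸ˣ)) → (∀ (x : TSite d (fineP L m)) (X : 𝔸), τ (AdA (g x) X) = τ X) →
        (∀ (x : TSite d (fineP L m)) (v v' : W), ⟪AdW φ (g x) v, AdW φ (g x) v'⟫_ℂ = ⟪v, v'⟫_ℂ) →
        ∀ (hU1' : ∀ (x : B7Prop1Explicit.Site d) (κ : Fin d), perCfg (fineP L m) (gaugeU g U) x κ ∈ U1 𝔸)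
          (hreg' : ∀ (y : TSite d m) (κ : Fin d) (r : Fin d → Fin L),
            ‖((Wcx L (perCfg (fineP L m) (gaugeU g U)) (cornerSite L y) κ (boxVec L r) : 𝔸ˣ) : 𝔸) - 1‖ ≤ α)
          (hpos' : ∀ x : BondL2K ℂ d (fineP L m) c₀ W, x ≠ 0 →
            0 < RCLike.re ⟪x, laplaceAofBackground L m hL φ (gaugeU g U) hα1 hU1' hreg' τ η (c₀ := c₀) (c₁ := c₁) a x⟫_ℂ)
          (y : BondL2K ℂ d (fineP L m) c₀ W), ‖G1LatticeK hpos' y‖ ≤ γ₁⁻¹ * ‖y‖ := by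
  obtain ⟨γ₁, ε₃, hγ₁, hε₃, H⟩ :=
    exists_coercive_laplaceA_of_small_field_uniform L hL φ (c₀ := c₀) (c₁ := c₁) hη ha hMφ hMφ' hφ hφ' τ hτC hCτ
  refine ⟨γ₁, ε₃, hγ₁, hε₃, fun m _ U α hα1 hU1 hreg ε hε hεε₃ hUε hRS g hstar hτ hAd hU1' hreg' hpos' y => ?_⟩
  exact norm_G1_le_gaugeU L hL φ τ η m U hα1 hU1 hreg hU1' hreg' hτ hstar hAd a hγ₁ (H m U hα1 hU1 hreg hε hεε₃ hUε hRS) hpos' y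

end Orbit

end Literature.MathematicalPhysics.QuantumFieldTheory.Balaban1983to89.B9Thm311GaugeOrbitClosed

end
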